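import Summits.QuantumFields.BalabanUV.Beta.CovariantTowerRowData

/-!
# Beta / CovariantTowerThreshold — «M sufficiently large» MADE EXPLICIT for the junction: the smallness parameter of the
# walk inversion of the k-fold covariant tower operator decays like C/M₀ and the decoration rate shift like κ₁P⋆/M₀, so
# for every rate κ < θ_D and every decoration strength κ₁ ≥ 0 there is an explicit M₀⋆ beyond which ALL hypotheses of
# `CovariantTowerRowData.rowData_tower_torus` ∕ `termSum_tower_torus_one` hold — the (I1)-SHAPE theorems are NOT vacuous
# (unit `b2b-balaban-beta-d4-p2`, GEN 5; fifth module of the chain `CovariantTowerMatrix → … → CovariantTowerRowData → this`)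

HONEST FRAMING: discharging `BetaPertH` makes Bałaban's UV stability UNCONDITIONAL — NOT the continuum limit, NOT the
Clay problem.  HONEST DEPENDENCY (verbatim): «continuum YM on T⁴ ⇐ BetaPertH ∧ nine spine estimates (0/9 proved);
BetaPertH ⇐ (D1) ∧ (D4) ∧ CAP+tail; G-an2-4 gates asym, D1 and NE2/3/4.»  THIS MODULE DISCHARGES NOTHING of `BetaPertH`,
asserts NOTHING printed and cites nothing as a fact (ABSOLUTE RULE): [folklore] real arithmetic about the MODEL constants
(SHAPE modelled: [B9] = `Balaban1985BackgroundPropagators` Thm 3.7 p. 409 «for M sufficiently large» and [II] =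
`Balaban1988RG2Cluster` (1.11) p. 5 «If m is big enough … δ₀d(ω) ≥ δ₁mM»: the partition scale absorbs the decoration).

CONTENT.
* §1 `latticeConst_anti` (b04's Λ_d(a) is antitone in a > 0), `localConst_mono`/`momentConst_mono` (C_L, K₁ monotone in the
  rate below θ_D), uniform bounds `coverNumber_le` (gen 4), `packNumber_le` (P ≤ (15 + 8S_k)^d =: P⋆), `rateShift_le`,
  `wrsSmallness_le` (ρ(M₀, κ) ≤ 8d·(7 + 4S_k)^d·C_L(κ̄)·K₁(κ̄)/M₀ for κ ≤ κ̄ < θ_D).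
* §2 **`exists_threshold`**: ∀ κ < θ_D, ∀ κ₁ ≥ 0, ∃ M₀⋆, ∀ M₀ ≥ M₀⋆: κ + κ₁P(M₀)/M₀ < θ_D ∧ ρ(M₀, κ + κ₁P(M₀)/M₀) < 1.
Row D4: RECORDS value (non-vacuity of the junction's smallness hypotheses); class of (T3)/NODE O.2 unchanged; D4 DISCHARGE
NO DATE; NOT BetaPertH, NOT continuum, NOT Clay.
-/

namespace Summit.QuantumFields.BalabanUV.Beta.CovariantTowerThreshold

open Finset
open Literature.MathematicalPhysics.QuantumFieldTheory.Balaban1983to89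
open Summit.QuantumFields.BalabanUV.Beta.CovariantTowerDecay (towerS)
open Summit.QuantumFields.BalabanUV.Beta.CovariantTowerCover (coverNumber coverNumber_nonneg coverNumber_le)
open Summit.QuantumFields.BalabanUV.Beta.CovariantTowerLocal
open Summit.QuantumFields.BalabanUV.Beta.CovariantTowerWRS
open Summit.QuantumFields.BalabanUV.Beta.CovariantTowerRowData

noncomputable section

/-! ## §1  Monotonicity and uniform bounds of the constants -/

/-- **b04's lattice constant is antitone in the rate**: 0 < a ≤ b ⇒ Λ_d(b) ≤ Λ_d(a). [folklore] -/
theorem latticeConst_anti (d : ℕ) {a b : ℝ} (ha : 0 < a) (hab : a ≤ b) :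
    B4Sect5Proof.latticeConst d b ≤ B4Sect5Proof.latticeConst d a := by
  unfold B4Sect5Proof.latticeConst
  have hd : (0 : ℝ) ≤ d := Nat.cast_nonneg d
  have hea : Real.exp (-(a / d)) ≤ 1 := Real.exp_le_one_iff.mpr (by have := div_nonneg ha.le hd; linarith)
  have heb : Real.exp (-(b / d)) ≤ Real.exp (-(a / d)) :=
    Real.exp_le_exp.mpr (by have := div_le_div_of_nonneg_right hab hd; linarith)
  rcases Nat.eq_zero_or_pos d with hd0 | hdpos
  · subst hd0; simp
  have hdpos' : (0 : ℝ) < d := by exact_mod_cast hdpos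
  have hea' : Real.exp (-(a / d)) < 1 := Real.exp_lt_one_iff.mpr (by have := div_pos ha hdpos'; linarith)
  have h1 : 0 < 1 - Real.exp (-(a / d)) := by linarith
  have h2 : 1 - Real.exp (-(a / d)) ≤ 1 - Real.exp (-(b / d)) := by linarith
  have h3 : (1 - Real.exp (-(b / d)))⁻¹ ≤ (1 - Real.exp (-(a / d)))⁻¹ := inv_anti₀ h1 h2
  exact pow_le_pow_left₀ (mul_nonneg (by norm_num) (inv_nonneg.mpr (by linarith))) (by linarith) d

/-- **C_L is monotone in the rate below θ_D**: κ ≤ κ̄ < θ_D ⇒ C_L(κ) ≤ C_L(κ̄). [folklore] -/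
theorem localConst_mono (d : ℕ) (M : ℕ → ℕ) {amin wmin : ℝ} (cmin cmax wmax : ℝ) (k : ℕ) (a : Fin (k + 1) → ℝ)
    (nC : ℕ) {κ κbar : ℝ} (hκ : κ ≤ κbar) (hbar : κbar < thetaD d M amin wmin cmin cmax wmax k a) (hamin : 0 < amin)
    (hwmin : 0 < wmin) :
    localConst d M amin wmin cmin cmax wmax k a nC κ ≤ localConst d M amin wmin cmin cmax wmax k a nC κbar := by
  unfold localConst
  have hσ := sigmaD_pos d M cmin k hamin hwmin
  refine mul_le_mul_of_nonneg_left (mul_le_mul_of_nonneg_left ?_ (Nat.cast_nonneg _)) (div_nonneg (by norm_num) hσ.le)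
  exact latticeConst_anti d (sub_pos.mpr hbar) (by linarith)

/-- **K₁ is monotone in the rate** (κ ≤ κ̄; Λ_k ≥ 0, D_k ≥ 0). [folklore] -/
theorem momentConst_mono (d : ℕ) (M : ℕ → ℕ) (cmax wmax : ℝ) (k : ℕ) {a : Fin (k + 1) → ℝ}
    (ha : ∀ l, 0 ≤ a l) (nC : ℕ) {κ κbar : ℝ} (hκ : κ ≤ κbar) :
    momentConst d M cmax wmax k a nC κ ≤ momentConst d M cmax wmax k a nC κbar := by
  unfold momentConst
  have hΛ : 0 ≤ towerLambda d M cmax wmax k a := by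
    unfold towerLambda
    refine add_nonneg (by positivity) (Finset.sum_nonneg fun l _ => mul_nonneg (ha l) (by positivity))
  have hD := rangeTower_nonneg d M k
  refine mul_le_mul_of_nonneg_left ?_ (mul_nonneg hΛ (by positivity))
  exact mul_le_mul_of_nonneg_left (Real.exp_le_exp.mpr (mul_le_mul_of_nonneg_right hκ hD)) hD

/-- MODEL bookkeeping: **the uniform packing bound** P⋆ = (15 + 8S_k)^d. [folklore] -/
def packStar (d : ℕ) (M : ℕ → ℕ) (k : ℕ) : ℝ := (15 + 8 * (towerS (fun j => d * (M j - 1)) k : ℝ)) ^ d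

/-- **P(M₀) ≤ P⋆** for M₀ ≥ 1 (the packing number of the cells at radius R = 3M₀ + 2 + 4S_k). [folklore] -/
theorem packNumber_le (d : ℕ) (M : ℕ → ℕ) (k : ℕ) {M₀ : ℕ} (hM₀ : 1 ≤ M₀) :
    (packNumber d M k M₀ : ℝ) ≤ packStar d M k := by
  unfold packNumber packStar
  have hM0 : (1 : ℝ) ≤ M₀ := by exact_mod_cast hM₀
  set S := (towerS (fun j => d * (M j - 1)) k : ℝ) with hS
  have hS0 : 0 ≤ S := Nat.cast_nonneg _
  have hq : (packR d M k M₀ + M₀) / M₀ ≤ 6 + 4 * S := by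
    unfold packR omegaDiam
    rw [← hS, div_le_iff₀ (by linarith)]
    nlinarith [mul_nonneg (sub_nonneg.mpr hM0) (by positivity : (0 : ℝ) ≤ 2 + 4 * S)]
  have hbase : 0 ≤ 2 * ((packR d M k M₀ + M₀) / M₀) + 3 := by
    have : 0 ≤ (packR d M k M₀ + M₀) / M₀ := by
      unfold packR; exact div_nonneg (add_nonneg (add_nonneg (Nat.cast_nonneg _) (omegaDiam_nonneg d M k M₀))
        (Nat.cast_nonneg _)) (by linarith)
    linarith
  calc ((⌊(2 * ((packR d M k M₀ + M₀) / M₀) + 3) ^ d⌋₊ : ℕ) : ℝ)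
      ≤ (2 * ((packR d M k M₀ + M₀) / M₀) + 3) ^ d := Nat.floor_le (pow_nonneg hbase d)
    _ ≤ (15 + 8 * S) ^ d := pow_le_pow_left₀ hbase (by linarith) d

/-- **The rate shift is ≤ κ₁P⋆/M₀.** [folklore] -/
theorem rateShift_le (d : ℕ) (M : ℕ → ℕ) (k : ℕ) {M₀ : ℕ} (hM₀ : 1 ≤ M₀) {κ₁ : ℝ} (hκ₁ : 0 ≤ κ₁) :
    rateShift d M k M₀ κ₁ ≤ κ₁ * packStar d M k / M₀ := by
  unfold rateShift
  have hM0 : (0 : ℝ) < M₀ := by exact_mod_cast hM₀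
  rw [mul_div_assoc]
  exact mul_le_mul_of_nonneg_left (div_le_div_of_nonneg_right (packNumber_le d M k hM₀) hM0.le) hκ₁

/-- The rate shift is ≥ 0. [folklore] -/
theorem rateShift_nonneg (d : ℕ) (M : ℕ → ℕ) (k M₀ : ℕ) {κ₁ : ℝ} (hκ₁ : 0 ≤ κ₁) : 0 ≤ rateShift d M k M₀ κ₁ := by
  unfold rateShift; positivity

/-- MODEL bookkeeping: **the M₀-free majorant of M₀·ρ(M₀, κ)**, 8d·(7 + 4S_k)^d·C_L(κ)·K₁(κ). [folklore] -/
def smallStar (d : ℕ) (M : ℕ → ℕ) (amin wmin cmin cmax wmax : ℝ) (k : ℕ) (a : Fin (k + 1) → ℝ) (nC : ℕ) (κ : ℝ) :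
    ℝ :=
  8 * d * (7 + 4 * (towerS (fun j => d * (M j - 1)) k : ℝ)) ^ d *
    localConst d M amin wmin cmin cmax wmax k a nC κ * momentConst d M cmax wmax k a nC κ

/-- **ρ(M₀, κ) ≤ smallStar(κ̄)/M₀ for κ ≤ κ̄ < θ_D** (cover number ≤ (7 + 4S_k)^d, C_L and K₁ monotone in the rate).
[folklore] -/
theorem wrsSmallness_le (d : ℕ) (M : ℕ → ℕ) {amin wmin : ℝ} (cmin cmax wmax : ℝ) (k : ℕ)
    {a : Fin (k + 1) → ℝ} (ha : ∀ l, 0 ≤ a l) (nC : ℕ) {M₀ : ℕ} (hM₀ : 1 ≤ M₀) {κ κbar : ℝ}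
    (hκ : κ ≤ κbar) (hbar : κbar < thetaD d M amin wmin cmin cmax wmax k a) (hamin : 0 < amin) (hwmin : 0 < wmin) :
    wrsSmallness d M amin wmin cmin cmax wmax k a nC M₀ κ ≤ smallStar d M amin wmin cmin cmax wmax k a nC κbar / M₀ := by
  unfold wrsSmallness smallStar
  have hd0 : (0 : ℝ) ≤ d := Nat.cast_nonneg d
  have hM0 : (0 : ℝ) < M₀ := by exact_mod_cast hM₀
  have hν := coverNumber_le (d := d) (M := M) k hM₀
  have hν0 := coverNumber_nonneg d M k M₀
  have hC := localConst_mono d M cmin cmax wmax k a nC hκ hbar hamin hwmin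
  have hC0 := localConst_nonneg d M cmin cmax wmax k a nC (hκ.trans hbar.le) hamin hwmin
  have hK := momentConst_mono d M cmax wmax k ha nC hκ
  have hK0 : 0 ≤ momentConst d M cmax wmax k a nC κ := by
    unfold momentConst towerLambda
    have := rangeTower_nonneg d M k
    refine mul_nonneg (mul_nonneg (add_nonneg (by positivity)
      (Finset.sum_nonneg fun l _ => mul_nonneg (ha l) (by positivity))) (by positivity)) (by positivity)
  have e : 2 * coverNumber d M k M₀ / ((M₀ : ℝ) / (4 * d)) = 8 * d * coverNumber d M k M₀ / M₀ := by
    field_simp; ring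
  rw [e]
  calc 8 * d * coverNumber d M k M₀ / M₀ * localConst d M amin wmin cmin cmax wmax k a nC κ *
        momentConst d M cmax wmax k a nC κ
      = (8 * d * coverNumber d M k M₀ * localConst d M amin wmin cmin cmax wmax k a nC κ *
          momentConst d M cmax wmax k a nC κ) / M₀ := by ring
    _ ≤ (8 * d * (7 + 4 * (towerS (fun j => d * (M j - 1)) k : ℝ)) ^ d *
          localConst d M amin wmin cmin cmax wmax k a nC κbar * momentConst d M cmax wmax k a nC κbar) / M₀ := by
        refine div_le_div_of_nonneg_right ?_ hM0.le
        refine mul_le_mul (mul_le_mul (mul_le_mul_of_nonneg_left hν (by positivity)) hC hC0 (by positivity)) hK hK0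
          (mul_nonneg (by positivity) (hC0.trans hC))

/-! ## §2  The explicit threshold -/

/-- **«M SUFFICIENTLY LARGE», EXPLICITLY: for every rate κ < θ_D and every decoration strength κ₁ ≥ 0 there is M₀⋆
such that for all M₀ ≥ M₀⋆ the shifted rate κ′ = κ + κ₁P(M₀)/M₀ stays below θ_D AND the smallness ρ(M₀, κ′) < 1** —
i.e. every smallness hypothesis of `rowData_tower_torus` ∕ `termSum_tower_torus_one` ∕ `walkInversion_tower_torus` holds
for all large partition scales (the torus conditions M₀ ∣ N_i, 2M₀ ≤ N_i being conditions on the volume only).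
Witness: M₀⋆ = ⌈2κ₁P⋆/(θ_D − κ)⌉₊ + ⌈smallStar(κ̄)⌉₊ + 2 with κ̄ = (κ + θ_D)/2. [folklore] -/
theorem exists_threshold (d : ℕ) (M : ℕ → ℕ) {amin wmin : ℝ} (cmin cmax wmax : ℝ) (k : ℕ)
    {a : Fin (k + 1) → ℝ} (ha : ∀ l, 0 ≤ a l) (nC : ℕ) (hamin : 0 < amin) (hwmin : 0 < wmin) {κ κ₁ : ℝ}
    (hκ : κ < thetaD d M amin wmin cmin cmax wmax k a) (hκ₁ : 0 ≤ κ₁) :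
    ∃ M₀star : ℕ, ∀ M₀ : ℕ, M₀star ≤ M₀ →
      κ + rateShift d M k M₀ κ₁ < thetaD d M amin wmin cmin cmax wmax k a ∧
        wrsSmallness d M amin wmin cmin cmax wmax k a nC M₀ (κ + rateShift d M k M₀ κ₁) < 1 := by
  set θ := thetaD d M amin wmin cmin cmax wmax k a with hθ
  set κbar := (κ + θ) / 2 with hκbar
  have hκbar1 : κ < κbar := by rw [hκbar]; linarith
  have hκbar2 : κbar < θ := by rw [hκbar]; linarith
  set Pstar := packStar d M k with hP
  have hP0 : 0 ≤ Pstar := by rw [hP]; unfold packStar; positivity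
  set Sstar := smallStar d M amin wmin cmin cmax wmax k a nC κbar with hSstar
  refine ⟨⌈2 * κ₁ * Pstar / (θ - κ)⌉₊ + ⌈Sstar⌉₊ + 2, fun M₀ hM₀ => ?_⟩
  have hM₀1 : 1 ≤ M₀ := by omega
  have hM0 : (0 : ℝ) < M₀ := by exact_mod_cast hM₀1
  have hMreal : (⌈2 * κ₁ * Pstar / (θ - κ)⌉₊ : ℝ) + ⌈Sstar⌉₊ + 2 ≤ M₀ := by exact_mod_cast hM₀
  have hc1 : 2 * κ₁ * Pstar / (θ - κ) ≤ ⌈2 * κ₁ * Pstar / (θ - κ)⌉₊ := Nat.le_ceil _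
  have hc2 : Sstar ≤ ⌈Sstar⌉₊ := Nat.le_ceil _
  -- the shifted rate stays below κ̄
  have hshift : rateShift d M k M₀ κ₁ ≤ κ₁ * Pstar / M₀ := rateShift_le d M k hM₀1 hκ₁
  have hgap : 0 < θ - κ := sub_pos.mpr hκ
  have hκ' : κ + rateShift d M k M₀ κ₁ ≤ κbar := by
    have h1 : κ₁ * Pstar / M₀ ≤ (θ - κ) / 2 := by
      rw [div_le_iff₀ hM0]
      have h2 : 2 * κ₁ * Pstar / (θ - κ) * (θ - κ) = 2 * κ₁ * Pstar := div_mul_cancel₀ _ hgap.ne'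
      have h3 : 2 * κ₁ * Pstar / (θ - κ) ≤ M₀ := by
        have : (0 : ℝ) ≤ ⌈Sstar⌉₊ := Nat.cast_nonneg _
        linarith
      nlinarith
    rw [hκbar]; linarith
  refine ⟨lt_of_le_of_lt hκ' hκbar2, ?_⟩
  -- the smallness at the shifted rate
  have hρ := wrsSmallness_le d M cmin cmax wmax k ha nC hM₀1 hκ' hκbar2 hamin hwmin
  have hS1 : Sstar / M₀ < 1 := by
    rw [div_lt_one hM0]
    have : (0 : ℝ) ≤ ⌈2 * κ₁ * Pstar / (θ - κ)⌉₊ := Nat.cast_nonneg _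
    linarith
  exact lt_of_le_of_lt hρ hS1

end

end Summit.QuantumFields.BalabanUV.Beta.CovariantTowerThreshold
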